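import Literature.Algebra.EuclideanLattices.MRGapCVPVerifierZInt
import Literature.Algebra.EuclideanLattices.MRGapCVPIdealisedZ
import Literature.Algebra.EuclideanLattices.MRGapCVPRunD
import Literature.Algebra.EuclideanLattices.DualGridQuality
import HarnessLib

/-!
# The machine verifier of MR07 Thm. 5.23 on the dual-grid data: soundness on YES instances and the passage from the analysed event on NO instances — proved

Topic `Algebra/EuclideanLattices` (family `pqc`). The machine of Micciancio–Regev 2007, Thm. 5.23 ends by
evaluating the all-integer predicate `intAcceptsZ t a b D P u` (`MRGapCVPVerifierZInt`, computed by
`MRVerifierMachine.verdictF`) on the witness numerators `uⱼ ∈ Λ = dualLat I.basis = Dg·L(B)*` produced by the runs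
of `W` (`MRGapCVPRunD`), with `D = Dg`, the integer target `t` and `d = a/b` of the `GapCVP′` instance. This
file connects that predicate with the two analyses of the tree:

* YES instances — **`not_intAcceptsZ_of_infDist_le`**: if `dist(t, L(B)) ≤ d` then the machine's predicate
  fails for ANY `uⱼ ∈ Λ` (`P ≥ 1`, `N_w ≥ 1`): the true dual vectors `wⱼ = uⱼ/Dg ∈ L(B)*`
  (`DualGridQuality.smul_mem_dualLattice_of_mem_dualLat`) would pass tests (b′), (c) with `θ_b = 3/80`,
  `Θ = 3N_w/(100d²)` (`testB/testC_of_intAcceptsZ`), contradicting `MRGapCVPIdealisedZ.not_acceptsZ_of_infDist_le`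
  (`Θd² = 3N_w/100 < 3N_w/80`) — so on YES instances the reduction NEVER answers "NO instance", whatever the
  randomness (MR07 p. 29: "V outputs No whenever dist(t, L(B)) ≤ d");
* NO instances — **`intAcceptsZ_of_acceptsZ`**: the analysed event `acceptsZ L₀ t′ θ_b Θ′` of
  `MRGapCVPBlocksD` (`L₀ = Λ*`, `t′ = t/Dg`, witnesses `uⱼ` read in `(Λ*)*`) with `θ_b ≥ 3/80` and the slack
  `n(Θ′d²/Dg²)^{2^P} ≤ (3N_w/100)^{2^P}` implies the machine's predicate (`intAcceptsZ_of_tests`; the phases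
  agree, `⟨t/Dg, uⱼ⟩ = ⟨t, uⱼ/Dg⟩`, and the quadratic form scales by `Dg²`).

All proved; no named fact.

## References

* D. Micciancio, O. Regev, *Worst-case to average-case reductions based on Gaussian measures*,
  SIAM J. Comput. 37 (2007) 267–302; authors' version, Thm. 5.23 and its proof (the verifier, pp. 28–31).
* D. Aharonov, O. Regev, *Lattice problems in NP ∩ coNP*, J. ACM 52 (2005) 749–765, §6.1.
-/

noncomputable section

open scoped Classical Real InnerProductSpace

namespace Literature.Algebra.EuclideanLattices

open Module Submodule Matrix GSInverse Finset Metric MicciancioRegev2007 MicciancioRegev2007.VerifierZ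
  Literature.NumberTheory.Sieve.Vinogradov

namespace DualGrid

variable {I : LatticeInstance} {Nw : ℕ}

/-- The denominator `Dg = det(B)²` as a natural number, and its casts. [folklore] -/
theorem cast_Dg_toNat (hI : I.IsNonsingular) : (((Dg I.basis).toNat : ℕ) : ℝ) = ((Dg I.basis : ℤ) : ℝ) := by
  have h : ((Dg I.basis).toNat : ℤ) = Dg I.basis := Int.toNat_of_nonneg (Dg_pos hI).le
  exact_mod_cast h

/-- `Dg.toNat > 0`. [folklore] -/
theorem Dg_toNat_pos (hI : I.IsNonsingular) : 0 < (Dg I.basis).toNat := Int.lt_toNat.2 (by simpa using Dg_pos hI)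

/-- **The phases agree**: `⟨t/Dg, uⱼ⟩ = ⟨t, uⱼ/Dg⟩` (`witness Dg u j = uⱼ/Dg`). [folklore] -/
theorem inner_smul_target_eq (hI : I.IsNonsingular) (t : Fin I.n → ℤ) (u : Fin Nw → Fin I.n → ℤ) (j : Fin Nw) :
    ⟪((Dg I.basis : ℤ) : ℝ)⁻¹ • intVecToEuclidean I.n t, intVecToEuclidean I.n (u j)⟫_ℝ =
      ⟪intVecToEuclidean I.n t, witness (Dg I.basis).toNat u j⟫_ℝ := by
  rw [witness, cast_Dg_toNat hI, real_inner_smul_left, real_inner_smul_right]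

/-! ### YES instances: the machine's predicate fails -/

/-- **On a YES instance the machine's verifier rejects every tuple of dual-grid witnesses.** If
`dist(t, L(B)) ≤ d` (`d = a/b > 0`), `uⱼ ∈ Λ = dualLat I.basis` for all `j < N_w` (`N_w ≥ 1`) and `P ≥ 1`, then
`¬ intAcceptsZ t d.num d.den Dg P u`. [cite: MicciancioRegev2007, Thm. 5.23 (proof, p. 29: "V outputs No whenever dist(t, L(B)) ≤ d") — integer form] -/
theorem not_intAcceptsZ_of_infDist_le (hI : I.IsNonsingular) {u : Fin Nw → Fin I.n → ℤ}
    (hu : ∀ j, intVecToEuclidean I.n (u j) ∈ dualLat I.basis) {t : Fin I.n → ℤ} {d : ℚ} (hd : 0 < d)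
    (hdist : infDist (intVecToEuclidean I.n t) ((I.lattice : Set (EuclideanSpace ℝ (Fin I.n)))) ≤ d)
    (hNw : 1 ≤ Nw) {P : ℕ} (hP : 1 ≤ P) :
    ¬ intAcceptsZ t d.num d.den (Dg I.basis).toNat P u := by
  intro hacc
  haveI : IsZLattice ℝ I.lattice := LatticeInstance.isZLattice_of_isNonsingular hI
  have hD : 0 < (Dg I.basis).toNat := Dg_toNat_pos hI
  have ha : d.num ≠ 0 := (Rat.num_pos.2 hd).ne'
  have hb : 0 < d.den := d.den_pos
  have hdR : ((d.num : ℤ) : ℝ) / (d.den : ℕ) = (d : ℝ) := by rw [Rat.cast_def]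
  -- the true dual vectors `wⱼ = uⱼ / Dg ∈ L(B)*`
  have hmem : ∀ j, witness (Dg I.basis).toNat u j ∈ dualLattice I.lattice := fun j => by
    rw [witness, cast_Dg_toNat hI]
    exact smul_mem_dualLattice_of_mem_dualLat hI (hu j)
  set o : Fin Nw → Option (dualLattice I.lattice) := fun j => some ⟨_, hmem j⟩ with ho
  have hB' := testB_of_intAcceptsZ hD hacc
  have hC' := testC_of_intAcceptsZ ha hb hD hP hacc
  have haccZ : acceptsZ I.lattice (intVecToEuclidean I.n t) (3 / 80)
      (3 * Nw / (100 * ((d : ℝ)) ^ 2)) o := by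
    refine ⟨fun j => by simp [ho], ?_, fun x => ?_⟩
    · simpa only [ho, Option.getD_some] using hB'
    · have h := hC' x
      rw [hdR] at h
      simpa only [ho, Option.getD_some] using h
  have hdpos : (0 : ℝ) < d := by exact_mod_cast hd
  refine not_acceptsZ_of_infDist_le I.lattice hdist (by positivity) ?_ o haccZ
  exact theta_c_lt_theta_b hNw hdpos.ne'

/-! ### NO instances: the analysed event implies the machine's predicate -/

/-- The witnesses `uⱼ ∈ Λ` read in `(Λ*)*`, all present. [folklore] -/
def someW [IsZLattice ℝ (dualLat I.basis)] (u : Fin Nw → Fin I.n → ℤ) (hu : ∀ j, intVecToEuclidean I.n (u j) ∈ dualLat I.basis) :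
    Fin Nw → Option (WLat I.basis) :=
  fun j => some ⟨_, mem_WLat_of_mem (hu j)⟩

/-- **The analysed event implies the machine's predicate** (NO case): `acceptsZ L₀ (t/Dg) θ_b Θ′ (someW u)`
(`L₀ = Λ*`) with `θ_b ≥ 3/80`, `Θ′ ≥ 0` and the slack `n(Θ′/Dg² · d²)^{2^P} ≤ (3N_w/100)^{2^P}` (`P ≥ 1`,
`d = a/b`) gives `intAcceptsZ t d.num d.den Dg P u`.
[cite: MicciancioRegev2007, Thm. 5.23 (proof, NO case, pp. 29–31) — trace/residual form of the tests] -/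
theorem intAcceptsZ_of_acceptsZ [IsZLattice ℝ (dualLat I.basis)] (hI : I.IsNonsingular) {u : Fin Nw → Fin I.n → ℤ}
    (hu : ∀ j, intVecToEuclidean I.n (u j) ∈ dualLat I.basis) {t : Fin I.n → ℤ} {d : ℚ} {θb Θ' : ℝ} {P : ℕ}
    (hP : 1 ≤ P) (hθb : (3 / 80 : ℝ) ≤ θb) (hΘ'0 : 0 ≤ Θ')
    (hslack : (I.n : ℝ) * (Θ' / ((Dg I.basis : ℤ) : ℝ) ^ 2 * (d : ℝ) ^ 2) ^ (2 ^ P) ≤ (3 * Nw / 100) ^ (2 ^ P))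
    (hacc : acceptsZ (dualLattice (dualLat I.basis)) (((Dg I.basis : ℤ) : ℝ)⁻¹ • intVecToEuclidean I.n t) θb Θ' (someW u hu)) :
    intAcceptsZ t d.num d.den (Dg I.basis).toNat P u := by
  obtain ⟨-, hb', hc'⟩ := hacc
  have hD : 0 < (Dg I.basis).toNat := Dg_toNat_pos hI
  have hDr : (0 : ℝ) < ((Dg I.basis : ℤ) : ℝ) := by exact_mod_cast Dg_pos hI
  have hdR : ((d.num : ℤ) : ℝ) / (d.den : ℕ) = (d : ℝ) := by rw [Rat.cast_def]
  refine intAcceptsZ_of_tests (Θ := Θ' / ((Dg I.basis : ℤ) : ℝ) ^ 2) d.den_pos hD hP hθb (div_nonneg hΘ'0 (sq_nonneg _)) ?_ ?_ ?_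
  · rw [hdR]; exact hslack
  · -- (b′): the phases agree
    refine le_of_le_of_eq hb' (Finset.sum_congr rfl fun j _ => ?_)
    simp only [someW, Option.getD_some]
    rw [inner_smul_target_eq hI]
  · -- (c): the quadratic form scales by `Dg²`
    intro x
    have h := hc' x
    simp only [someW, Option.getD_some] at h
    have hscale : ∀ j, ⟪x, witness (Dg I.basis).toNat u j⟫_ℝ ^ 2 = (((Dg I.basis : ℤ) : ℝ) ^ 2)⁻¹ * ⟪x, intVecToEuclidean I.n (u j)⟫_ℝ ^ 2 :=
      fun j => by rw [witness, cast_Dg_toNat hI, real_inner_smul_right]; field_simp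
    simp only [hscale, ← Finset.mul_sum]
    rw [inv_mul_le_iff₀ (by positivity)]
    refine h.trans (le_of_eq ?_)
    field_simp

end DualGrid

end Literature.Algebra.EuclideanLattices

end
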